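import Summits.ABC.ABC.Theses.IneffectiveSubspace
import Summits.ABC.ABC.Theorems.IneffectiveSubspaceUniformSadicTowerFourQuarticRootWall
import Summits.ABC.ABC.Theorems.IneffectiveSubspaceUniformSadicTowerFourHarmonicThue
import Summits.ABC.ABC.Theorems.IneffectiveSubspaceUniformSadicTowerFourGaussianNormalForm
import Summits.ABC.ABC.Theorems.IneffectiveSubspaceUniformSadicTowerFourCellRawS
import Summits.ABC.ABC.Theorems.IneffectiveSubspaceUniformSadicTowerFourCellSettledHalf

/-!
# Line `SketchIdeator4` (crux stmt-ABC-14937 `UniformSadicTowerFour`) — the lead's record of the line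

This is NOT a skeleton: the line (card `Ideas/gaussian-thue-pell-square.md`) is a MAP of one cell of
the `K = 0` face and has no composition `UniformSadicTowerFour_of` (see `Lines/SketchIdeator4.dead.md`).
What it delivered is LANDED under `Theorems/` (all `--supports stmt-ABC-14937`, sorry-free, standard
axioms) and is indexed here by `example`s that elaborate against the tree:

* p115100 `…UniformSadicTowerFourQuarticRootWall.lean` — crux ⟹ `CellRaw` ⟹ `PellSquareCell` ⟺ `W₄`;
* p116483 `…UniformSadicTowerFourHarmonicThue.lean` — `PellSquareCell` ⟺ uniform harmonic quartic
  Thue bound in `ℤ[i]`, crux ⟹ it; trivial exponent, oddness, Ljunggren's point;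
* p115768 `…UniformSadicTowerFourGaussianNormalForm.lean` — the dictionary `t + i = μ·ν⁴` (unconditional);
* p116395 `…UniformSadicTowerFourCellRawS.lean` — the `K ≥ 1` reading (S-part excused, linear S-loss);
* p116621 `Literature/NumberTheory/DiophantineGeometry/SimplestQuarticThue.lean` — named facts
  Chen–Voutier 1997 Thm 3 (= Lettl–Pethő 1995) and Thm 4 (the settled count/structure half);
* p116781 `…UniformSadicTowerFourCellSettledHalf.lean` — conditional on those facts: the unit slice
  `μ = C ± i`, `|C| ≥ 2` is empty and Ljunggren's `1 + t² = 2n⁴ ⟹ n ∈ {1, 13}`.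
-/

namespace Summit.ABC.ABC.Cruxes.UniformSadicTowerFour.SketchIdeator4

open Summit.ABC.ABC.Theses.IneffectiveSubspace
open Summit.ABC.ABC.Theorems.UniformSadicTowerFour

/-- crux ⟹ `W₄` (the quartic-root wall). -/
example (hU : UniformSadicTowerFour) :
    ∀ ε : ℝ, 0 < ε → ∃ C : ℝ, 0 < C ∧ ∀ t n : ℕ, 0 < t → 0 < n → n ^ 4 ∣ t ^ 2 + 1 →
      (n : ℝ) ^ 3 ≤ C * (t : ℝ) ^ (1 + ε) :=
  QuarticRootWall.quarticRootWall_of_uniformSadicTowerFour hU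

/-- crux ⟹ uniform harmonic quartic Thue bound. -/
example (hU : UniformSadicTowerFour) :
    ∀ ε : ℝ, 0 < ε → ∃ C : ℝ, 0 < C ∧ ∀ μ ν : GaussianInt,
      ((μ * ν ^ 4).im = 1 ∨ (μ * ν ^ 4).im = -1) →
      (ν.norm : ℝ) ≤ C * (μ.norm : ℝ) ^ ((1 : ℝ) / 2 + ε) :=
  QuarticRootWall.uniformHarmonicThue_of_uniformSadicTowerFour hU

/-- the dictionary. -/
example : ∀ t m n : ℕ, 1 + t ^ 2 = m * n ^ 4 →
    ∃ μ ν : GaussianInt, μ.norm = m ∧ ν.norm = n ∧ (⟨(t : ℤ), 1⟩ : GaussianInt) = μ * ν ^ 4 :=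
  GaussianNormalForm.gaussianNormalForm

/-- the settled half (conditional on Chen–Voutier Thm 3): Ljunggren. -/
example (h : Literature.NumberTheory.DiophantineGeometry.SimplestQuarticThueSolutions) :
    ∀ t n : ℕ, 1 + t ^ 2 = 2 * n ^ 4 → n = 1 ∨ n = 13 :=
  QuarticRootWall.ljunggren_of_simplestQuarticThue h

end Summit.ABC.ABC.Cruxes.UniformSadicTowerFour.SketchIdeator4
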